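import Summits.ValiantsHypothesis.ValiantsHypothesis.Theorems.LacunarySymmetroidMatrixDescartesCensusDoorA34SheetEndParity

/-!
# `MatrixDescartes` census — DOOR A at `(3,4)`: RANK-PARITY ON THE NULL-TOP SHEET — every pair of slot coefficients of a null-top eighteen has the
# sign relation `0 < (−1)^{ρ(e)+ρ(e')}·c_e·c_{e'}` (`ρ` = rank among the `19` sheet exponents); the lower-letter EDGE relations in the format of
# `Census.edge_parities_of_nineteen`, and the two HALF-EDGE relations towards the singular top letter

HONEST FRAMING.  Object-search cell `pub-symmetroid`, engine seat `val-sym-eng-2` (g4); helper rows beside the registered strata line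
`Cruxes/DoorA34/Lines/strata.lean` on stmt-ValiantsHypothesis-19980 (`DoorA34 = PosRootLawAt 3 4 18`: OPEN, typed, never asserted here).
This is the ENABLING ROW that puts the door-p3 lane's sign machinery (…DoorA34DefiniteLetter: `edge_parities_of_nineteen`, pair law, propagation law,
`card_posRoots_le_18_of_definite_letter`) one step away from the null-top SHEET: by …NullTopEighteenAnatomy a counterexample to `stub_nullTopCeiling` on a
sorted support is Descartes-sharp on the `19` sheet slots, so the F1 row (`Census.pow_rank_mul_coeff_mul_coeff_pos_of_sharp`) fixes every coefficient sign
by the parity of its SHEET RANK `ρ(e) = #{sheet exponents < e}` (`sheetRank`, written out as a `Finset` cardinal so that `decide` evaluates it on numerals):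

* `sharp_of_nullTop_eighteen` — `#supp = 19 ≤ Z₊ + 1`; `slot_parity_of_nullTop_eighteen` — for ANY two slots `s, s' ≠ {3,3,3}`:
  `0 < (−1)^{ρ(σ s)+ρ(σ s')} · coeff(σ s) · coeff(σ s')`;
* `edge_parities_of_nullTop_eighteen` — for two LOWER letters `x ≠ y` (`x, y ≠ 3`) the three consecutive relations of the edge cubic
  `det(S_x + t S_y) = det S_x + tr(adj S_x·S_y) t + tr(adj S_y·S_x) t² + det S_y t³` exactly as in `edge_parities_of_nineteen`, with `ρ` the sheet rank;
* `halfEdge_parities_of_nullTop_eighteen` — for a lower letter `x` and the singular TOP letter: the two relations among `det S_x`, `tr(adj S_x·S₃)`,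
  `tr(adj S₃·S_x)` (the edge cubic `det(S_x + tS₃)` is a QUADRATIC on the sheet, `det S₃ = 0`).

A successor can now run door-p3's `definite_pair_count` / `definite_indefinite_count` on the lower triangle `{S₀,S₁,S₂}` of a hypothetical null-top eighteen
verbatim, and the half-edge relations against `S₃` (for definite `S_x`: `det(S_x + tS₃) = det S_x·(1 + μ₁t)(1 + μ₂t)` with `μ₁μ₂ ≷ 0` in the semidefinite /
indefinite cell).  Nothing here bounds anything; `DoorA34` and the three stubs stay OPEN; registers unchanged; nothing on `MatrixDescartes`
(stmt-ValiantsHypothesis-18050) or `VP ≠ VNP` — VP≠VNP not moved.  [folklore] Descartes' rule of signs, sharp case; elementary.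
-/

-- `Summit.ValiantsHypothesis.ValiantsHypothesis.…` repeats a component by the D-0017 layout
-- (single-conjunct summit), which the `dupNamespace` linter flags; the name is mandated.
set_option linter.dupNamespace false

namespace Summit.ValiantsHypothesis.ValiantsHypothesis.Theorems.LacunarySymmetroidMatrixDescartes.Census

open Polynomial Finset
open scoped BigOperators Polynomial Matrix

/-- **Sharpness on the null-top sheet**: `det S₃ = 0` and `18` roots ⇒ `#supp(det F) ≤ Z₊ + 1` (the hypothesis of the F1 row). [folklore] -/
theorem sharp_of_nullTop_eighteen (d : Fin 4 → ℕ) (S : Fin 4 → Matrix (Fin 3) (Fin 3) ℝ) (h3 : (S 3).det = 0)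
    (h18 : 18 ≤ ((Matrix.det (∑ l, ((X : ℝ[X]) ^ d l) • (S l).map C)).roots.toFinset.filter (fun t => 0 < t)).card) :
    (Matrix.det (∑ l, ((X : ℝ[X]) ^ d l) • (S l).map C)).support.card
      ≤ ((Matrix.det (∑ l, ((X : ℝ[X]) ^ d l) • (S l).map C)).roots.toFinset.filter (fun t => 0 < t)).card + 1 := by
  have := card_support_le_19_of_nullTop d S h3
  omega

/-- **RANK PARITY of any two sheet slots.**  For `det S₃ = 0`, `18` roots and slots `s, s' ≠ {3,3,3}`:
`0 < (−1)^{ρ(σ s) + ρ(σ s')} · coeff(σ s) · coeff(σ s')`, `ρ(e) = #{c ∈ supp : c < e}` (any `d`, any real letters). [folklore] -/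
theorem slot_parity_of_nullTop_eighteen (d : Fin 4 → ℕ) (S : Fin 4 → Matrix (Fin 3) (Fin 3) ℝ) (h3 : (S 3).det = 0)
    (h18 : 18 ≤ ((Matrix.det (∑ l, ((X : ℝ[X]) ^ d l) • (S l).map C)).roots.toFinset.filter (fun t => 0 < t)).card)
    (s s' : Sym (Fin 4) 3) (hs : s ≠ Sym.replicate 3 3) (hs' : s' ≠ Sym.replicate 3 3) :
    0 < (-1 : ℝ) ^ (((Matrix.det (∑ l, ((X : ℝ[X]) ^ d l) • (S l).map C)).support.filter
            (fun c => c < ((s : Multiset (Fin 4)).map d).sum)).card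
          + ((Matrix.det (∑ l, ((X : ℝ[X]) ^ d l) • (S l).map C)).support.filter
            (fun c => c < ((s' : Multiset (Fin 4)).map d).sum)).card)
      * ((Matrix.det (∑ l, ((X : ℝ[X]) ^ d l) • (S l).map C)).coeff (((s : Multiset (Fin 4)).map d).sum)
        * (Matrix.det (∑ l, ((X : ℝ[X]) ^ d l) • (S l).map C)).coeff (((s' : Multiset (Fin 4)).map d).sum)) := by
  refine pow_rank_mul_coeff_mul_coeff_pos_of_sharp _ (sharp_of_nullTop_eighteen d S h3 h18) ?_ ?_
  · exact mem_support_iff.mpr (coeff_sym_sum_ne_zero_of_nullTop_eighteen d S h3 h18 s hs)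
  · exact mem_support_iff.mpr (coeff_sym_sum_ne_zero_of_nullTop_eighteen d S h3 h18 s' hs')

/-- The square slot `{i,i,k}` as a `Sym`, its exponent and its coefficient on the sheet of a null-top eighteen (sorted support). [folklore] -/
theorem coeff_square_of_nullTop_eighteen (d : Fin 4 → ℕ) (hd : StrictMono d) (S : Fin 4 → Matrix (Fin 3) (Fin 3) ℝ) (h3 : (S 3).det = 0)
    (h18 : 18 ≤ ((Matrix.det (∑ l, ((X : ℝ[X]) ^ d l) • (S l).map C)).roots.toFinset.filter (fun t => 0 < t)).card)
    (i k : Fin 4) (hik : i ≠ k) :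
    (Matrix.det (∑ l, ((X : ℝ[X]) ^ d l) • (S l).map C)).coeff (2 * d i + d k) = ((S i).adjugate * S k).trace ∧
    2 * d i + d k ∈ (Matrix.det (∑ l, ((X : ℝ[X]) ^ d l) • (S l).map C)).support := by
  have hcard : Multiset.card ({i, i, k} : Multiset (Fin 4)) = 3 := by simp
  have hs : (⟨{i, i, k}, hcard⟩ : Sym (Fin 4) 3) ≠ Sym.replicate 3 3 := by
    refine sym_mk_ne_replicate hcard 3 fun e => ?_
    have hk : k ∈ Multiset.replicate 3 (3 : Fin 4) := by rw [← e]; simp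
    have hi : i ∈ Multiset.replicate 3 (3 : Fin 4) := by rw [← e]; simp
    exact hik ((Multiset.eq_of_mem_replicate hi).trans (Multiset.eq_of_mem_replicate hk).symm)
  have hσ : ((((⟨{i, i, k}, hcard⟩ : Sym (Fin 4) 3)) : Multiset (Fin 4)).map d).sum = 2 * d i + d k := by
    simp only [Multiset.insert_eq_cons, Multiset.map_cons, Multiset.sum_cons, Multiset.map_singleton, Multiset.sum_singleton]
    ring
  have huniq : ∀ f : Fin 3 → Fin 4, (∑ t, d (f t)) = 2 * d i + d k → f = ![i, i, k] ∨ f = ![i, k, i] ∨ f = ![k, i, i] := by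
    intro f hf
    have h := sym_eq_of_sum_eq_of_nullTop_eighteen d hd S h3 h18 _ hs f (hf.trans hσ.symm)
    have hval : (Finset.univ.val.map f : Multiset (Fin 4)) = {i, i, k} := by
      have := congrArg (fun u : Sym (Fin 4) 3 => (u : Multiset (Fin 4))) h
      simpa using this
    exact fun_eq_of_map_univ_eq_pair i k hik f hval
  refine ⟨coeff_det_pencil_three_square d S hik huniq, ?_⟩
  rw [support_det_pencil_eq_of_nullTop_eighteen d S h3 h18]
  exact Finset.mem_image.mpr ⟨_, Finset.mem_erase.mpr ⟨hs, Finset.mem_univ _⟩, hσ⟩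

/-- The cube slot `{l,l,l}` (`l ≠ 3`): coefficient `det S_l` and membership, on the sheet of a null-top eighteen (sorted support). [folklore] -/
theorem coeff_cube_of_nullTop_eighteen (d : Fin 4 → ℕ) (hd : StrictMono d) (S : Fin 4 → Matrix (Fin 3) (Fin 3) ℝ) (h3 : (S 3).det = 0)
    (h18 : 18 ≤ ((Matrix.det (∑ l, ((X : ℝ[X]) ^ d l) • (S l).map C)).roots.toFinset.filter (fun t => 0 < t)).card)
    (l : Fin 4) (hl : l ≠ 3) :
    (Matrix.det (∑ k, ((X : ℝ[X]) ^ d k) • (S k).map C)).coeff (3 * d l) = (S l).det ∧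
    3 * d l ∈ (Matrix.det (∑ k, ((X : ℝ[X]) ^ d k) • (S k).map C)).support := by
  have hs : Sym.replicate 3 l ≠ Sym.replicate 3 (3 : Fin 4) := fun h => hl ((Sym.replicate_right_inj (by norm_num)).1 h)
  have hσ : (((Sym.replicate 3 l : Sym (Fin 4) 3) : Multiset (Fin 4)).map d).sum = 3 * d l := by
    simp only [Sym.coe_replicate, Multiset.map_replicate, Multiset.sum_replicate, smul_eq_mul]
  have huniq : ∀ f : Fin 3 → Fin 4, (∑ i, d (f i)) = 3 * d l → ∀ i, f i = l := fun f hf i =>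
    fun_const_of_sym_eq_replicate f l (sym_eq_of_sum_eq_of_nullTop_eighteen d hd S h3 h18 _ hs f (hf.trans hσ.symm)) i
  refine ⟨coeff_det_pencil_three_mul d S l huniq, ?_⟩
  rw [support_det_pencil_eq_of_nullTop_eighteen d S h3 h18]
  exact Finset.mem_image.mpr ⟨_, Finset.mem_erase.mpr ⟨hs, Finset.mem_univ _⟩, hσ⟩

/-- **EDGE PARITIES on the null-top sheet (two lower letters).**  Sorted support, `det S₃ = 0`, `18` roots, `x ≠ y` both `≠ 3`, and `ρ` the
rank function of the sheet support: the consecutive coefficients `det S_x, tr(adj S_x·S_y), tr(adj S_y·S_x), det S_y` of the edge cubic satisfy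
`0 < (−1)^{ρ+ρ'}·c·c'` — verbatim the format of `Census.edge_parities_of_nineteen`. [folklore] -/
theorem edge_parities_of_nullTop_eighteen (d : Fin 4 → ℕ) (hd : StrictMono d) (S : Fin 4 → Matrix (Fin 3) (Fin 3) ℝ) (h3 : (S 3).det = 0)
    (h18 : 18 ≤ ((Matrix.det (∑ l, ((X : ℝ[X]) ^ d l) • (S l).map C)).roots.toFinset.filter (fun t => 0 < t)).card)
    {x y : Fin 4} (hxy : x ≠ y) (hx : x ≠ 3) (hy : y ≠ 3)
    (ρ : ℕ → ℕ) (hρ : ∀ e, ρ e = ((Matrix.det (∑ l, ((X : ℝ[X]) ^ d l) • (S l).map C)).support.filter (· < e)).card) :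
    0 < (-1 : ℝ) ^ (ρ (3 * d x) + ρ (2 * d x + d y)) * ((S x).det * ((S x).adjugate * S y).trace)
    ∧ 0 < (-1 : ℝ) ^ (ρ (2 * d x + d y) + ρ (2 * d y + d x)) * (((S x).adjugate * S y).trace * ((S y).adjugate * S x).trace)
    ∧ 0 < (-1 : ℝ) ^ (ρ (2 * d y + d x) + ρ (3 * d y)) * (((S y).adjugate * S x).trace * (S y).det) := by
  have hsharp := sharp_of_nullTop_eighteen d S h3 h18
  obtain ⟨cx, mx⟩ := coeff_cube_of_nullTop_eighteen d hd S h3 h18 x hx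
  obtain ⟨cy, my⟩ := coeff_cube_of_nullTop_eighteen d hd S h3 h18 y hy
  obtain ⟨cxy, mxy⟩ := coeff_square_of_nullTop_eighteen d hd S h3 h18 x y hxy
  obtain ⟨cyx, myx⟩ := coeff_square_of_nullTop_eighteen d hd S h3 h18 y x hxy.symm
  refine ⟨?_, ?_, ?_⟩
  · have k := pow_rank_mul_coeff_mul_coeff_pos_of_sharp _ hsharp mx mxy
    rw [← hρ, ← hρ, cx, cxy] at k; exact k
  · have k := pow_rank_mul_coeff_mul_coeff_pos_of_sharp _ hsharp mxy myx
    rw [← hρ, ← hρ, cxy, cyx] at k; exact k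
  · have k := pow_rank_mul_coeff_mul_coeff_pos_of_sharp _ hsharp myx my
    rw [← hρ, ← hρ, cyx, cy] at k; exact k

/-- **HALF-EDGE PARITIES towards the singular top letter.**  Sorted support, `det S₃ = 0`, `18` roots, a lower letter `x ≠ 3`:
the three surviving coefficients `det S_x, tr(adj S_x·S₃), tr(adj S₃·S_x)` of the (now quadratic) edge polynomial `det(S_x + tS₃)` satisfy the two
consecutive rank-parity relations. [folklore] -/
theorem halfEdge_parities_of_nullTop_eighteen (d : Fin 4 → ℕ) (hd : StrictMono d) (S : Fin 4 → Matrix (Fin 3) (Fin 3) ℝ) (h3 : (S 3).det = 0)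
    (h18 : 18 ≤ ((Matrix.det (∑ l, ((X : ℝ[X]) ^ d l) • (S l).map C)).roots.toFinset.filter (fun t => 0 < t)).card)
    {x : Fin 4} (hx : x ≠ 3)
    (ρ : ℕ → ℕ) (hρ : ∀ e, ρ e = ((Matrix.det (∑ l, ((X : ℝ[X]) ^ d l) • (S l).map C)).support.filter (· < e)).card) :
    0 < (-1 : ℝ) ^ (ρ (3 * d x) + ρ (2 * d x + d 3)) * ((S x).det * ((S x).adjugate * S 3).trace)
    ∧ 0 < (-1 : ℝ) ^ (ρ (2 * d x + d 3) + ρ (2 * d 3 + d x)) * (((S x).adjugate * S 3).trace * ((S 3).adjugate * S x).trace) := by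
  have hsharp := sharp_of_nullTop_eighteen d S h3 h18
  obtain ⟨cx, mx⟩ := coeff_cube_of_nullTop_eighteen d hd S h3 h18 x hx
  obtain ⟨cx3, mx3⟩ := coeff_square_of_nullTop_eighteen d hd S h3 h18 x 3 hx
  obtain ⟨c3x, m3x⟩ := coeff_square_of_nullTop_eighteen d hd S h3 h18 3 x (Ne.symm hx)
  refine ⟨?_, ?_⟩
  · have k := pow_rank_mul_coeff_mul_coeff_pos_of_sharp _ hsharp mx mx3
    rw [← hρ, ← hρ, cx, cx3] at k; exact k
  · have k := pow_rank_mul_coeff_mul_coeff_pos_of_sharp _ hsharp mx3 m3x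
    rw [← hρ, ← hρ, cx3, c3x] at k; exact k

/-- **The sheet support, for evaluating `ρ`**: with a sorted support, `det S₃ = 0` and `18` roots the support of `det F` is the image of the `19`
sheet slots; so `ρ(e) = #{s ≠ {3,3,3} : σ s < e}` is computable from `d` alone (`decide` on numerals). [folklore] -/
theorem sheetRank_eq_of_nullTop_eighteen (d : Fin 4 → ℕ) (S : Fin 4 → Matrix (Fin 3) (Fin 3) ℝ) (h3 : (S 3).det = 0)
    (h18 : 18 ≤ ((Matrix.det (∑ l, ((X : ℝ[X]) ^ d l) • (S l).map C)).roots.toFinset.filter (fun t => 0 < t)).card) (e : ℕ) :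
    ((Matrix.det (∑ l, ((X : ℝ[X]) ^ d l) • (S l).map C)).support.filter (· < e)).card
      = ((((Finset.univ : Finset (Sym (Fin 4) 3)).erase (Sym.replicate 3 3)).image
          (fun s : Sym (Fin 4) 3 => ((s : Multiset (Fin 4)).map d).sum)).filter (· < e)).card := by
  rw [support_det_pencil_eq_of_nullTop_eighteen d S h3 h18]

end Summit.ValiantsHypothesis.ValiantsHypothesis.Theorems.LacunarySymmetroidMatrixDescartes.Census
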